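import Summits.CriticalPhenomena.PercolationContinuityZ3.Theorems.PercNearOneGluingNoHeavyLowerTailSahiInterpTen

/-!
# Sahi's `C_10` on the cube `{0,1}^5` by the symmetry-reduced coloured-antichain check with the INTERPOLATION leaf test: COMPUTATIONAL chunk B

Support file (cell `prim-sahi`, seat `prim-sahi-typer` gen 30; `--supports stmt-CriticalPhenomena-4575`, computational).  One `native_decide`
evaluation of a range of …`SahiSymCubeCheck`'s `symCheckT 5 10 (testI 5 10 hTen cTen)`: canonical antichains `31, …, 209` of `canonE 5` (ONE order-10 interpolation test: the ten 2-subsets of `Fin 5`, canonical antichain `156`; ≈ 125 s).  The leaf test …`SahiInterpCheck.testI` evaluates `10^{50}·E_{10}(μ_{x/10})` at the `3 003` sorted grid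
points by the block-peeling DP, transforms with `H` (…`SahiInterpTen`) and checks the `161 051` entries `= c^5 · sahiCoef` to be `≥ 0`;
sound by …`SahiInterpSound.testI_sound`.  Assembled in …`SahiSymCubeFiveTen`. [this work]
-/

namespace Summit.CriticalPhenomena.PercolationContinuityZ3.Theorems.SahiSymCube

open SahiInterp

/-- Chunk B of the order-`10` check on `{0,1}^5` (interpolation leaf test). [this work, computational] -/
theorem symCheck_five_10_chunkB : symCheckFrom 5 10 (testI 5 10 hTen cTen) 31 = true := by
  native_decide

end Summit.CriticalPhenomena.PercolationContinuityZ3.Theorems.SahiSymCube
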